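import Literature.MathematicalPhysics.QuantumFieldTheory.Balaban1983to89.B6L2BlockHprimeTermsV1
import Literature.MathematicalPhysics.QuantumFieldTheory.Balaban1983to89.B6L2BlockSmoothTermsV1
import Literature.MathematicalPhysics.QuantumFieldTheory.Balaban1983to89.B6Prop25L2LocTwoScaleV1

/-!
# `Balaban1983to89.B6Prop25Grad2DecayTwoScaleV1` — T. Bałaban, *Propagators and renormalization transformations for lattice gauge theories. II*,
# Commun. Math. Phys. **96** (1984) 223–250 [Balaban1984PropagatorsII], PROPOSITION 2.5 p. 246, THE MEMBERS `‖ζ∇∇GJ‖` AND `‖ζG∇*∇*J‖` OF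
# (1.114) FOR THE GENUINE TWO-SCALE `G = Δ_a⁻¹` OF (2.90), `Λ′ ⊂ T^{(j+1)}` ARBITRARY, for `tsV1` at the paper's scaling — file 27, the assembly
# of the two-derivative `ℓ²` members of the two-level decay programme (files 23, 24, 25a, 25b, 26)

statement-level skeleton of published theorems with citation tags; proofs where landed; nothing here is a claim about the Yang–Mills mass gap

p. 246 (Proposition 2.5, verbatim): *"The operator G defined by (2.90) … has the representation (2.129) and satisfies all the inequalities
(1.110)–(1.114) of the Proposition 1.2 with a positive constant δ₂ instead of δ₀. This constant depends on d and L only."*  [4] (1.114) p. 36: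
*"Finally there exists a constant O(1) such that ‖ζGJ‖, ‖ζ∇GJ‖, ‖ζG∇*J‖, ‖ζ∇G∇*J‖, ‖ζ∇∇GJ‖, ‖ζG∇*∇*J‖ ≤ O(1)e^{−δ₀|y−y′|}|ζ|‖J‖ (1.114) for
supp ζ ⊂ Δ̃(y), supp J ⊂ Δ̃(y′)."*

WHAT THIS FILE DOES.  §1 the operator identity: two fine derivatives on (2.129) (file 1's `G_eq_op_V1`), with `(I − K₂)* = I − K₂*` and
`G̃_j + H_jC̃H_j* = G^{(w′)}R₀` (file 25b's `M_eq_GE_comp_R0`, `w′ = n^{d+1}`):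
`∇_λ∇_μG = ∇_λ∇_μK₁ + (∇_λ∇_μG^{(w′)})·R₀(I − K₂) − (∇_λ∇_μK₂*)·(G̃_j + H_jC̃H_j*)(I − K₂)` (`DDG_eq`).  §2 **`l2blk_DDG_scaling`**: the `ℓ²`-BLOCK
bound of `∇_λ∇_μG`, uniform — `∃ δ₂ > 0, C ≥ 0` (on `d, L, a₀, a₁`) such that for every volume, `j + 1 ≤ m + K`, `Λ′`, weights
`a₀n^{d+1} ≤ w ≤ a₁n^{d+1}`, directions `λ, μ`, unit sites `y, y′`, fine bond fields `v` over `B^j(y)`, `u` over `B^j(y′)`: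
`|⟨v, ∇_λ∇_μGu⟩| ≤ C·e^{−δ₂|y − y′|_T}‖v‖‖u‖` — file 24's `∇∇G^{(w′)}` ([4]'s (1.114) member BY NAME) composed with file 25b's `R₀(I − K₂)`, file 25a's
`∇∇K₂*` with file 25b's `M(I − K₂)`, plus file 25a's `∇∇K₁` (file 23's `l2blk_comp/add/sub`).  §3 THE PRINTED SHAPES: **`prop25_ineq114_gradgrad`**
— `Σ_{b₀}(ζ(b₀₋)(∇_λ∇_μGJ)(b₀))² ≤ (C·e^{(1+2δ₂)r}·e^{−δ₂|y−y′|_T}·Z)²·‖J‖²`, i.e. `‖ζ∇_λ∇_μGJ‖ ≤ C e^{(1+2δ₂)r}e^{−δ₂|y−y′|}|ζ|‖J‖`, for `J`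
supported on the fine bonds over the unit sites within `r` of `y′`, `ζ` supported over those within `r` of `y`, `|ζ| ≤ Z` (file 23's
`normSq_cut_apply_le_of_l2blk`); and by adjunction (`G* = G`, file 15; `(∇_λ∇_μG)* = G∇_μ*∇_λ*`) **`prop25_ineq114_GDadjDadj`** — the member
`‖ζG∇*∇*J‖` per pair of directions.
HONEST SCOPE / DIVERGENCES. (1) The members are given per pair `(λ, μ)`; r03's census functionals sum them (`(d+1)²` pairs). (2) With files 15, 16,
22 this leaves only the member `‖ζ∇G∇*J‖` of (1.114) (and the Hölder members (1.111)–(1.113), p38) for the two-scale `G`. (3) `c = L^j`, weights in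
[4]'s window, `w′ = n^{d+1}`; `C, δ₂` depend on `d, L, a₀, a₁` only; constants ours and crude. (4) No new definition, no new hypothesis: files 1–26 and
[4] Prop. 1.2 (b05/r02's proof, via file 24) BY NAME.  NOT summit progress.  Unit `lit-balaban-p22` (gen 16), 2026-08-22.
-/

noncomputable section

open scoped InnerProductSpace BigOperators Matrix
open Finset

namespace Literature.MathematicalPhysics.QuantumFieldTheory.Balaban1983to89.B6Prop25Grad2DecayTwoScaleV1

open LatticeFieldCalculus B5SectBStatements B5Eq117TorusCarriers B6SectADomainsV1 B6SectAOperatorsV1 B6SectAVectorModelV1 B6SectCOperators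
  B6SectCTwoScaleV1 B6SectCTwoScaleV1Lattice B5Eq118OneStroke
open BalabanImbrieJaffe1984to88.BIJ85AxialPropagator411 (BondSpace)
open B4Sect5Torus (IsPseudoDist SumBound)
open B4TorusKernel.MultiPeriod (torusSupNorm torusSupNorm_nonneg)
open B4Sect5Proof (latticeConst latticeConst_nonneg)
open B5Local114GLattice (const114 delta114 const114_pos delta114_pos)
open B6LowerBound2153Torus (rep)
open B6Repr2129Operator (G_eq_op_V1)
open B6BlockDecayCalculus (torusDist_isPseudoDist torusDist_sumBound)
open B6BlockDecayGDivBridgeV1 (adjoint_Dop)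
open B6L2BlockCalculus (l2blk_comp l2blk_adjoint l2blk_add l2blk_sub l2blk_mono l2blk_id normSq_cut_apply_le_of_l2blk)
open B6L2Block114GEV1 (l2blk_DDGE_scaling)
open B6L2BlockHprimeTermsV1 (l2blk_DDK1_scaling l2blk_DDK2adj_scaling)
open B6L2BlockSmoothTermsV1 (M_eq_GE_comp_R0 l2blk_R0_scaling l2blk_M_scaling l2blk_K2_scaling)
open B6Prop25L2LocTwoScaleV1 (adjoint_G_V1)

variable {d L m K : ℕ} {hd : 1 ≤ d + 1} {hL : Odd L ∧ 1 < L} {j : ℕ}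

/-! ## §1  The operator identity: two fine derivatives on (2.129) -/

section Identity

variable (hc : ((L : ℝ) ^ j) ≠ 0) (hj : j + 1 ≤ (⟨d + 1, L, m, K, hd, hL⟩ : Params).m + (⟨d + 1, L, m, K, hd, hL⟩ : Params).K) (Λ' : Finset (Site (⟨d + 1, L, m, K, hd, hL⟩ : Params) (j + 1))) {w : CIdx j Λ' → ℝ} (hw : ∀ i, 0 < w i)
  (hw' : (0 : ℝ) < 1 * ((L : ℝ) ^ j) ^ (d + 1))

include hj hw in
/-- two fine derivatives on (2.129), `(I − K₂)* = I − K₂*`: `∇_λ∇_μG = ∇_λ∇_μK₁ + (∇_λ∇_μM)(I − K₂) − (∇_λ∇_μK₂*)(M(I − K₂))`, `M = G̃_j + H_jC̃H_j*`.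
[cite: Balaban1984PropagatorsII, (2.129) p.246] -/
theorem DDG_eq_M (lam mu : Fin (d + 1)) :
    (((((L : ℝ) ^ j) • (onE (LinearMap.funLeft ℝ ℝ (fun b : PBond (⟨d + 1, L, m, K, hd, hL⟩ : Params) 0 => (⟨b.src.shift lam, b.dir⟩ : PBond (⟨d + 1, L, m, K, hd, hL⟩ : Params) 0))) - LinearMap.id) : BondSpace (⟨d + 1, L, m, K, hd, hL⟩ : Params) →ₗ[ℝ] BondSpace (⟨d + 1, L, m, K, hd, hL⟩ : Params))) ∘ₗ ((((L : ℝ) ^ j) • (onE (LinearMap.funLeft ℝ ℝ (fun b : PBond (⟨d + 1, L, m, K, hd, hL⟩ : Params) 0 => (⟨b.src.shift mu, b.dir⟩ : PBond (⟨d + 1, L, m, K, hd, hL⟩ : Params) 0))) - LinearMap.id) : BondSpace (⟨d + 1, L, m, K, hd, hL⟩ : Params) →ₗ[ℝ] BondSpace (⟨d + 1, L, m, K, hd, hL⟩ : Params))) ∘ₗ (tsV1 hc Λ' w).G) = (((((L : ℝ) ^ j) • (onE (LinearMap.funLeft ℝ ℝ (fun b : PBond (⟨d + 1, L, m, K, hd,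 hL⟩ : Params) 0 => (⟨b.src.shift lam, b.dir⟩ : PBond (⟨d + 1, L, m, K, hd, hL⟩ : Params) 0))) - LinearMap.id) : BondSpace (⟨d + 1, L, m, K, hd, hL⟩ : Params) →ₗ[ℝ] BondSpace (⟨d + 1, L, m, K, hd, hL⟩ : Params))) ∘ₗ ((((L : ℝ) ^ j) • (onE (LinearMap.funLeft ℝ ℝ (fun b : PBond (⟨d + 1, L, m, K, hd, hL⟩ : Params) 0 => (⟨b.src.shift mu, b.dir⟩ : PBond (⟨d + 1, L, m, K, hd, hL⟩ : Params) 0))) - LinearMap.id) : BondSpace (⟨d + 1, L, m, K, hd, hL⟩ : Params) →ₗ[ℝ] BondSpace (⟨d + 1, L, m, K, hd, hL⟩ : Params))) ∘ₗ (tsV1 hc Λ' w).K1) + (((((L : ℝ) ^ j) • (onE (LinearMap.funLeft ℝ ℝ (fun b : PBond (⟨d + 1, L, m, K, hd, hL⟩ : Params) 0 => (⟨b.src.shift lam, b.dir⟩ : PBond (⟨d + 1, L, m, K, hd, hL⟩ : Params) 0))) - LinearMap.id) : BondSpace (⟨d + 1, L, m, K, hd, hL⟩ : Params) →ₗ[ℝ]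 BondSpace (⟨d + 1, L, m, K, hd, hL⟩ : Params))) ∘ₗ ((((L : ℝ) ^ j) • (onE (LinearMap.funLeft ℝ ℝ (fun b : PBond (⟨d + 1, L, m, K, hd, hL⟩ : Params) 0 => (⟨b.src.shift mu, b.dir⟩ : PBond (⟨d + 1, L, m, K, hd, hL⟩ : Params) 0))) - LinearMap.id) : BondSpace (⟨d + 1, L, m, K, hd, hL⟩ : Params) →ₗ[ℝ] BondSpace (⟨d + 1, L, m, K, hd, hL⟩ : Params))) ∘ₗ ((tsV1 hc Λ' w).Gt + (tsV1 hc Λ' w).Hj ∘ₗ (tsV1 hc Λ' w).Ct ∘ₗ LinearMap.adjoint (tsV1 hc Λ' w).Hj)) ∘ₗ (LinearMap.id - (tsV1 hc Λ' w).K2) - (((((L : ℝ) ^ j) • (onE (LinearMap.funLeft ℝ ℝ (fun b : PBond (⟨d + 1, L, m, K, hd, hL⟩ : Params) 0 => (⟨b.src.shift lam, b.dir⟩ : PBond (⟨d + 1, L, m, K, hd, hL⟩ : Params) 0))) - LinearMap.id) : BondSpace (⟨d + 1, L, m, K, hd, hL⟩ : Params) →ₗ[ℝ] BondSpace (⟨d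 + 1, L, m, K, hd, hL⟩ : Params))) ∘ₗ ((((L : ℝ) ^ j) • (onE (LinearMap.funLeft ℝ ℝ (fun b : PBond (⟨d + 1, L, m, K, hd, hL⟩ : Params) 0 => (⟨b.src.shift mu, b.dir⟩ : PBond (⟨d + 1, L, m, K, hd, hL⟩ : Params) 0))) - LinearMap.id) : BondSpace (⟨d + 1, L, m, K, hd, hL⟩ : Params) →ₗ[ℝ] BondSpace (⟨d + 1, L, m, K, hd, hL⟩ : Params))) ∘ₗ LinearMap.adjoint (tsV1 hc Λ' w).K2) ∘ₗ (((tsV1 hc Λ' w).Gt + (tsV1 hc Λ' w).Hj ∘ₗ (tsV1 hc Λ' w).Ct ∘ₗ LinearMap.adjoint (tsV1 hc Λ' w).Hj) ∘ₗ (LinearMap.id - (tsV1 hc Λ' w).K2)) := by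
  have hadj : LinearMap.adjoint (LinearMap.id - (tsV1 hc Λ' w).K2) = LinearMap.id - LinearMap.adjoint (tsV1 hc Λ' w).K2 := by
    rw [map_sub, LinearMap.adjoint_id]
  rw [G_eq_op_V1 hc hj Λ' hw, hadj]
  simp only [LinearMap.comp_add, LinearMap.comp_sub, LinearMap.sub_comp, LinearMap.add_comp, LinearMap.id_comp, LinearMap.comp_id,
    LinearMap.comp_assoc]
  abel

include hw in
/-- **`∇_λ∇_μG = ∇_λ∇_μK₁ + (∇_λ∇_μG^{(w′)})·R₀(I − K₂) − (∇_λ∇_μK₂*)·M(I − K₂)`** (`M = G^{(w′)}R₀`, file 25b). [cite: Balaban1984PropagatorsII, (2.129)–(2.131) p.246] -/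
theorem DDG_eq (lam mu : Fin (d + 1)) : (((((L : ℝ) ^ j) • (onE (LinearMap.funLeft ℝ ℝ (fun b : PBond (⟨d + 1, L, m, K, hd, hL⟩ : Params) 0 => (⟨b.src.shift lam, b.dir⟩ : PBond (⟨d + 1, L, m, K, hd, hL⟩ : Params) 0))) - LinearMap.id) : BondSpace (⟨d + 1, L, m, K, hd, hL⟩ : Params) →ₗ[ℝ] BondSpace (⟨d + 1, L, m, K, hd, hL⟩ : Params))) ∘ₗ ((((L : ℝ) ^ j) • (onE (LinearMap.funLeft ℝ ℝ (fun b : PBond (⟨d + 1, L, m, K, hd, hL⟩ : Params) 0 => (⟨b.src.shift mu, b.dir⟩ : PBond (⟨d + 1, L, m, K, hd, hL⟩ : Params) 0))) - LinearMap.id) : BondSpace (⟨d + 1, L, m, K, hd, hL⟩ : Params) →ₗ[ℝ] BondSpace (⟨d + 1, L, m, K, hd, hL⟩ : Params))) ∘ₗ (tsV1 hc Λ' w).G) = ((((((L : ℝ) ^ j) • (onE (LinearMap.funLeft ℝ ℝ (fun b : PBond (⟨d + 1, L, m, K, hd, hL⟩ : Params) 0 => (⟨b.src.shift lam, b.dir⟩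 : PBond (⟨d + 1, L, m, K, hd, hL⟩ : Params) 0))) - LinearMap.id) : BondSpace (⟨d + 1, L, m, K, hd, hL⟩ : Params) →ₗ[ℝ] BondSpace (⟨d + 1, L, m, K, hd, hL⟩ : Params))) ∘ₗ ((((L : ℝ) ^ j) • (onE (LinearMap.funLeft ℝ ℝ (fun b : PBond (⟨d + 1, L, m, K, hd, hL⟩ : Params) 0 => (⟨b.src.shift mu, b.dir⟩ : PBond (⟨d + 1, L, m, K, hd, hL⟩ : Params) 0))) - LinearMap.id) : BondSpace (⟨d + 1, L, m, K, hd, hL⟩ : Params) →ₗ[ℝ] BondSpace (⟨d + 1, L, m, K, hd, hL⟩ : Params))) ∘ₗ (tsV1 hc Λ' w).K1) + (((((L : ℝ) ^ j) • (onE (LinearMap.funLeft ℝ ℝ (fun b : PBond (⟨d + 1, L, m, K, hd, hL⟩ : Params) 0 => (⟨b.src.shift lam, b.dir⟩ : PBond (⟨d + 1, L, m, K, hd, hL⟩ : Params) 0))) - LinearMap.id) : BondSpace (⟨d + 1, L, m, K, hd, hL⟩ : Params) →ₗ[ℝ] BondSpace (⟨d + 1, L, m, K, hd, hL⟩ : Params)))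 ∘ₗ ((((L : ℝ) ^ j) • (onE (LinearMap.funLeft ℝ ℝ (fun b : PBond (⟨d + 1, L, m, K, hd, hL⟩ : Params) 0 => (⟨b.src.shift mu, b.dir⟩ : PBond (⟨d + 1, L, m, K, hd, hL⟩ : Params) 0))) - LinearMap.id) : BondSpace (⟨d + 1, L, m, K, hd, hL⟩ : Params) →ₗ[ℝ] BondSpace (⟨d + 1, L, m, K, hd, hL⟩ : Params))) ∘ₗ (GE (Domains.whole (P := (⟨d + 1, L, m, K, hd, hL⟩ : Params)) j (Nat.le_of_succ_le hj)) hc (w := fun _ => 1 * ((L : ℝ) ^ j) ^ (d + 1)) (fun _ => hw'))) ∘ₗ (((LinearMap.id - LinearMap.adjoint (tsV1 hc Λ' w).Qv ∘ₗ ((tsV1 hc Λ' w).Δj + (1 * ((L : ℝ) ^ j) ^ (d + 1)) • (LinearMap.id : UBond (⟨d + 1, L, m, K, hd, hL⟩ : Params) j →ₗ[ℝ] UBond (⟨d + 1, L, m, K, hd, hL⟩ : Params) j)) ∘ₗ (tsV1 hc Λ' w).Qv ∘ₗ (GE (Domains.whole (P := (⟨d + 1, L, m, K, hd, hL⟩ :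 Params)) j (Nat.le_of_succ_le hj)) hc (w := fun _ => 1 * ((L : ℝ) ^ j) ^ (d + 1)) (fun _ => hw')) + LinearMap.adjoint (tsV1 hc Λ' w).Qv ∘ₗ ((tsV1 hc Λ' w).Δj + (1 * ((L : ℝ) ^ j) ^ (d + 1)) • (LinearMap.id : UBond (⟨d + 1, L, m, K, hd, hL⟩ : Params) j →ₗ[ℝ] UBond (⟨d + 1, L, m, K, hd, hL⟩ : Params) j)) ∘ₗ (tsV1 hc Λ' w).Ct ∘ₗ LinearMap.adjoint (tsV1 hc Λ' w).Hj : BondSpace (⟨d + 1, L, m, K, hd, hL⟩ : Params) →ₗ[ℝ] BondSpace (⟨d + 1, L, m, K, hd, hL⟩ : Params))) ∘ₗ (LinearMap.id - (tsV1 hc Λ' w).K2)) - (((((L : ℝ) ^ j) • (onE (LinearMap.funLeft ℝ ℝ (fun b : PBond (⟨d + 1, L, m, K, hd, hL⟩ : Params) 0 => (⟨b.src.shift lam, b.dir⟩ : PBond (⟨d + 1, L, m, K, hd, hL⟩ : Params) 0))) - LinearMap.id) : BondSpace (⟨d + 1, L, m, K, hd, hL⟩ : Params) →ₗ[ℝ]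 BondSpace (⟨d + 1, L, m, K, hd, hL⟩ : Params))) ∘ₗ ((((L : ℝ) ^ j) • (onE (LinearMap.funLeft ℝ ℝ (fun b : PBond (⟨d + 1, L, m, K, hd, hL⟩ : Params) 0 => (⟨b.src.shift mu, b.dir⟩ : PBond (⟨d + 1, L, m, K, hd, hL⟩ : Params) 0))) - LinearMap.id) : BondSpace (⟨d + 1, L, m, K, hd, hL⟩ : Params) →ₗ[ℝ] BondSpace (⟨d + 1, L, m, K, hd, hL⟩ : Params))) ∘ₗ LinearMap.adjoint (tsV1 hc Λ' w).K2) ∘ₗ (((tsV1 hc Λ' w).Gt + (tsV1 hc Λ' w).Hj ∘ₗ (tsV1 hc Λ' w).Ct ∘ₗ LinearMap.adjoint (tsV1 hc Λ' w).Hj) ∘ₗ (LinearMap.id - (tsV1 hc Λ' w).K2))) := by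
  have hM : ((((L : ℝ) ^ j) • (onE (LinearMap.funLeft ℝ ℝ (fun b : PBond (⟨d + 1, L, m, K, hd, hL⟩ : Params) 0 => (⟨b.src.shift lam, b.dir⟩ : PBond (⟨d + 1, L, m, K, hd, hL⟩ : Params) 0))) - LinearMap.id) : BondSpace (⟨d + 1, L, m, K, hd, hL⟩ : Params) →ₗ[ℝ] BondSpace (⟨d + 1, L, m, K, hd, hL⟩ : Params))) ∘ₗ ((((L : ℝ) ^ j) • (onE (LinearMap.funLeft ℝ ℝ (fun b : PBond (⟨d + 1, L, m, K, hd, hL⟩ : Params) 0 => (⟨b.src.shift mu, b.dir⟩ : PBond (⟨d + 1, L, m, K, hd, hL⟩ : Params) 0))) - LinearMap.id) : BondSpace (⟨d + 1, L, m, K, hd, hL⟩ : Params) →ₗ[ℝ] BondSpace (⟨d + 1, L, m, K, hd, hL⟩ : Params))) ∘ₗ ((tsV1 hc Λ' w).Gt + (tsV1 hc Λ' w).Hj ∘ₗ (tsV1 hc Λ' w).Ct ∘ₗ LinearMap.adjoint (tsV1 hc Λ' w).Hj) = (((((L : ℝ) ^ j) • (onE (LinearMap.funLeft ℝ ℝ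 (fun b : PBond (⟨d + 1, L, m, K, hd, hL⟩ : Params) 0 => (⟨b.src.shift lam, b.dir⟩ : PBond (⟨d + 1, L, m, K, hd, hL⟩ : Params) 0))) - LinearMap.id) : BondSpace (⟨d + 1, L, m, K, hd, hL⟩ : Params) →ₗ[ℝ] BondSpace (⟨d + 1, L, m, K, hd, hL⟩ : Params))) ∘ₗ ((((L : ℝ) ^ j) • (onE (LinearMap.funLeft ℝ ℝ (fun b : PBond (⟨d + 1, L, m, K, hd, hL⟩ : Params) 0 => (⟨b.src.shift mu, b.dir⟩ : PBond (⟨d + 1, L, m, K, hd, hL⟩ : Params) 0))) - LinearMap.id) : BondSpace (⟨d + 1, L, m, K, hd, hL⟩ : Params) →ₗ[ℝ] BondSpace (⟨d + 1, L, m, K, hd, hL⟩ : Params))) ∘ₗ (GE (Domains.whole (P := (⟨d + 1, L, m, K, hd, hL⟩ : Params)) j (Nat.le_of_succ_le hj)) hc (w := fun _ => 1 * ((L : ℝ) ^ j) ^ (d + 1)) (fun _ => hw'))) ∘ₗ ((LinearMap.id - LinearMap.adjoint (tsV1 hc Λ' w).Qv ∘ₗ ((tsV1 hc Λ' w).Δj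 + (1 * ((L : ℝ) ^ j) ^ (d + 1)) • (LinearMap.id : UBond (⟨d + 1, L, m, K, hd, hL⟩ : Params) j →ₗ[ℝ] UBond (⟨d + 1, L, m, K, hd, hL⟩ : Params) j)) ∘ₗ (tsV1 hc Λ' w).Qv ∘ₗ (GE (Domains.whole (P := (⟨d + 1, L, m, K, hd, hL⟩ : Params)) j (Nat.le_of_succ_le hj)) hc (w := fun _ => 1 * ((L : ℝ) ^ j) ^ (d + 1)) (fun _ => hw')) + LinearMap.adjoint (tsV1 hc Λ' w).Qv ∘ₗ ((tsV1 hc Λ' w).Δj + (1 * ((L : ℝ) ^ j) ^ (d + 1)) • (LinearMap.id : UBond (⟨d + 1, L, m, K, hd, hL⟩ : Params) j →ₗ[ℝ] UBond (⟨d + 1, L, m, K, hd, hL⟩ : Params) j)) ∘ₗ (tsV1 hc Λ' w).Ct ∘ₗ LinearMap.adjoint (tsV1 hc Λ' w).Hj : BondSpace (⟨d + 1, L, m, K, hd, hL⟩ : Params) →ₗ[ℝ] BondSpace (⟨d + 1, L, m, K, hd, hL⟩ : Params))) := by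
    rw [M_eq_GE_comp_R0 hc hj Λ' hw hw']
    simp only [LinearMap.comp_assoc]
  rw [DDG_eq_M hc hj Λ' hw lam mu, hM, LinearMap.comp_assoc]

include hj hw in
/-- `(∇_λ∇_μG)* = G∇_μ*∇_λ*` (`G* = G`, file 15; p22's `adjoint_Dop`). [cite: Balaban1984PropagatorsI, (1.89) p.33 («G∇*∇*J»); Balaban1984PropagatorsII, (2.90) p.239] -/
theorem adjoint_DDG_eq (lam mu : Fin (d + 1)) :
    LinearMap.adjoint (((((L : ℝ) ^ j) • (onE (LinearMap.funLeft ℝ ℝ (fun b : PBond (⟨d + 1, L, m, K, hd, hL⟩ : Params) 0 => (⟨b.src.shift lam, b.dir⟩ : PBond (⟨d + 1, L, m, K, hd, hL⟩ : Params) 0))) - LinearMap.id) : BondSpace (⟨d + 1, L, m, K, hd, hL⟩ : Params) →ₗ[ℝ] BondSpace (⟨d + 1, L, m, K, hd, hL⟩ : Params))) ∘ₗ ((((L : ℝ) ^ j) • (onE (LinearMap.funLeft ℝ ℝ (fun b : PBond (⟨d + 1, L, m, K, hd, hL⟩ : Params) 0 => (⟨b.src.shift mu, b.dir⟩ : PBond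 (⟨d + 1, L, m, K, hd, hL⟩ : Params) 0))) - LinearMap.id) : BondSpace (⟨d + 1, L, m, K, hd, hL⟩ : Params) →ₗ[ℝ] BondSpace (⟨d + 1, L, m, K, hd, hL⟩ : Params))) ∘ₗ (tsV1 hc Λ' w).G) = (tsV1 hc Λ' w).G ∘ₗ ((((L : ℝ) ^ j) • (onE (LinearMap.funLeft ℝ ℝ (fun b : PBond (⟨d + 1, L, m, K, hd, hL⟩ : Params) 0 => (⟨b.src.unshift mu, b.dir⟩ : PBond (⟨d + 1, L, m, K, hd, hL⟩ : Params) 0))) - LinearMap.id) : BondSpace (⟨d + 1, L, m, K, hd, hL⟩ : Params) →ₗ[ℝ] BondSpace (⟨d + 1, L, m, K, hd, hL⟩ : Params))) ∘ₗ ((((L : ℝ) ^ j) • (onE (LinearMap.funLeft ℝ ℝ (fun b : PBond (⟨d + 1, L, m, K, hd, hL⟩ : Params) 0 => (⟨b.src.unshift lam, b.dir⟩ : PBond (⟨d + 1, L, m, K, hd, hL⟩ : Params) 0))) - LinearMap.id) : BondSpace (⟨d + 1, L, m, K, hd, hL⟩ : Params) →ₗ[ℝ] BondSpace (⟨d + 1,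 L, m, K, hd, hL⟩ : Params))) := by
  rw [LinearMap.adjoint_comp, LinearMap.adjoint_comp, adjoint_Dop, adjoint_Dop, adjoint_G_V1 hc hj Λ' hw, LinearMap.comp_assoc]

end Identity

/-! ## §2  The `ℓ²`-block bound of `∇_λ∇_μG`, uniformly at the scaling -/

set_option maxRecDepth 8192 in
open Classical in
/-- **PROPOSITION 2.5, THE `ℓ²`-BLOCK BOUND OF `∇_λ∇_μG` FOR THE TWO-SCALE `G`** (`c = L^j`, weights `a₀n^{d+1} ≤ w ≤ a₁n^{d+1}`): there are
`δ₂ > 0`, `C ≥ 0` depending on `d, L, a₀, a₁` only such that for every volume, `j + 1 ≤ m + K`, `Λ′`, weights in the window, directions `λ, μ`,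
unit sites `y, y′` and fine bond fields `v` over `B^j(y)`, `u` over `B^j(y′)`: `|⟨v, ∇_λ∇_μGu⟩| ≤ C·e^{−δ₂|y − y′|_T}‖v‖‖u‖` — §1's identity,
[4] (1.114) for `∇∇G^{(w′)}` (file 24) and the smooth factors (files 25a, 25b), composed by file 23 (rates halved at each composition).
[cite: Balaban1984PropagatorsII, Prop. 2.5 p.246; Balaban1984PropagatorsI, Prop. 1.2 (1.114) p.36] -/
theorem l2blk_DDG_scaling (d L : ℕ) (hd : 1 ≤ d + 1) (hL : Odd L ∧ 1 < L) {a₀ a₁ : ℝ} (ha₀ : 0 < a₀) (ha₁ : a₀ ≤ a₁) :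
    ∃ δ : ℝ, 0 < δ ∧ ∃ C : ℝ, 0 ≤ C ∧ ∀ (m K : ℕ) (j : ℕ) (hc : ((L : ℝ) ^ j) ≠ 0)
      (hj : j + 1 ≤ (⟨d + 1, L, m, K, hd, hL⟩ : Params).m + (⟨d + 1, L, m, K, hd, hL⟩ : Params).K)
      (Λ' : Finset (Site (⟨d + 1, L, m, K, hd, hL⟩ : Params) (j + 1))) (w : CIdx j Λ' → ℝ)
      (_hw0 : ∀ i, a₀ * ((L : ℝ) ^ j) ^ (d + 1) ≤ w i) (_hw1 : ∀ i, w i ≤ a₁ * ((L : ℝ) ^ j) ^ (d + 1)) (lam mu : Fin (d + 1))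
      (y y' : Site (⟨d + 1, L, m, K, hd, hL⟩ : Params) j) (v u : BondSpace (⟨d + 1, L, m, K, hd, hL⟩ : Params))
      (_hv : ∀ b : PBond (⟨d + 1, L, m, K, hd, hL⟩ : Params) 0, iterBlockOf j b.src ≠ y → v b = 0) (_hu : ∀ b : PBond (⟨d + 1, L, m, K, hd, hL⟩ : Params) 0, iterBlockOf j b.src ≠ y' → u b = 0),
      |⟪v, (((((L : ℝ) ^ j) • (onE (LinearMap.funLeft ℝ ℝ (fun b : PBond (⟨d + 1, L, m, K, hd, hL⟩ : Params) 0 => (⟨b.src.shift lam, b.dir⟩ : PBond (⟨d + 1, L, m, K, hd, hL⟩ : Params) 0))) - LinearMap.id) : BondSpace (⟨d + 1, L, m, K, hd, hL⟩ : Params) →ₗ[ℝ] BondSpace (⟨d + 1, L, m, K, hd, hL⟩ : Params))) ∘ₗ ((((L : ℝ) ^ j) • (onE (LinearMap.funLeft ℝ ℝ (fun b : PBond (⟨d + 1, L, m, K, hd, hL⟩ : Params) 0 => (⟨b.src.shift mu, b.dir⟩ : PBond (⟨d + 1, L, m, K, hd, hL⟩ : Params) 0))) - LinearMap.id) : BondSpace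 (⟨d + 1, L, m, K, hd, hL⟩ : Params) →ₗ[ℝ] BondSpace (⟨d + 1, L, m, K, hd, hL⟩ : Params))) ∘ₗ (tsV1 hc Λ' w).G) u⟫_ℝ| ≤ C * Real.exp (-(δ * torusSupNorm (Mk (⟨d + 1, L, m, K, hd, hL⟩ : Params) j) (rep (Mk (⟨d + 1, L, m, K, hd, hL⟩ : Params) j) y - rep (Mk (⟨d + 1, L, m, K, hd, hL⟩ : Params) j) y'))) * (‖v‖ * ‖u‖) := by
  obtain ⟨δ₁, hδ₁, C₁, hC₁, hK1⟩ := l2blk_DDK1_scaling d L hd hL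
  obtain ⟨δ₂, hδ₂, C₂, hC₂, hK2a⟩ := l2blk_DDK2adj_scaling d L hd hL
  obtain ⟨δ₃, hδ₃, C₃, hC₃, hR0⟩ := l2blk_R0_scaling d L hd hL ha₀ ha₁
  obtain ⟨δ₄, hδ₄, C₄, hC₄, hM⟩ := l2blk_M_scaling d L hd hL ha₀ ha₁
  obtain ⟨δ₅, hδ₅, C₅, hC₅, hK2⟩ := l2blk_K2_scaling d L hd hL
  have hδ₆ : 0 < delta114 (d + 1) 1 := delta114_pos _ one_pos
  have hC₆ : 0 ≤ const114 (d + 1) 1 := (const114_pos _ _).le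
  -- the common rate and the halvings
  set δ₀ : ℝ := min (min (min δ₁ δ₂) (min δ₃ δ₄)) (min δ₅ (delta114 (d + 1) 1)) with hδ₀
  have hδ₀0 : 0 < δ₀ := lt_min (lt_min (lt_min hδ₁ hδ₂) (lt_min hδ₃ hδ₄)) (lt_min hδ₅ hδ₆)
  have h01 : δ₀ ≤ δ₁ := (min_le_left _ _).trans ((min_le_left _ _).trans (min_le_left _ _))
  have h02 : δ₀ ≤ δ₂ := (min_le_left _ _).trans ((min_le_left _ _).trans (min_le_right _ _))
  have h03 : δ₀ ≤ δ₃ := (min_le_left _ _).trans ((min_le_right _ _).trans (min_le_left _ _))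
  have h04 : δ₀ ≤ δ₄ := (min_le_left _ _).trans ((min_le_right _ _).trans (min_le_right _ _))
  have h05 : δ₀ ≤ δ₅ := (min_le_right _ _).trans (min_le_left _ _)
  have h06 : δ₀ ≤ delta114 (d + 1) 1 := (min_le_right _ _).trans (min_le_right _ _)
  set Ka : ℝ := latticeConst (d + 1) (δ₀ - δ₀ / 2) with hKa
  set Kb : ℝ := latticeConst (d + 1) (δ₀ - δ₀ / 4) with hKb
  have hKa0 : 0 ≤ Ka := latticeConst_nonneg _ (by linarith)
  have hKb0 : 0 ≤ Kb := latticeConst_nonneg _ (by linarith)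
  set C : ℝ := C₁ + const114 (d + 1) 1 * (C₃ * (1 + C₅) * Ka) * Kb + C₂ * (C₄ * (1 + C₅) * Ka) * Kb with hC
  have hC0 : 0 ≤ C := by positivity
  refine ⟨δ₀ / 4, by positivity, C, hC0, ?_⟩
  intro m K j hc hj Λ' w hw0 hw1 lam mu y y' v u hv hu
  have hL0 : 0 < L := by have := hL.2; omega
  haveI : NeZero L := ⟨by omega⟩
  have hLp : (0 : ℝ) < L := by exact_mod_cast hL0
  have hj' : j ≤ m + K := Nat.le_of_succ_le hj
  have hw : ∀ i, 0 < w i := fun i => lt_of_lt_of_le (by positivity) (hw0 i)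
  have hw' : (0 : ℝ) < 1 * ((L : ℝ) ^ j) ^ (d + 1) := by positivity
  have hρ : IsPseudoDist (fun t t' : Site (⟨d + 1, L, m, K, hd, hL⟩ : Params) j => torusSupNorm (Mk (⟨d + 1, L, m, K, hd, hL⟩ : Params) j) (rep (Mk (⟨d + 1, L, m, K, hd, hL⟩ : Params) j) t - rep (Mk (⟨d + 1, L, m, K, hd, hL⟩ : Params) j) t')) := torusDist_isPseudoDist (Mk (⟨d + 1, L, m, K, hd, hL⟩ : Params) j)
  have hK : SumBound (fun t t' : Site (⟨d + 1, L, m, K, hd, hL⟩ : Params) j => torusSupNorm (Mk (⟨d + 1, L, m, K, hd, hL⟩ : Params) j) (rep (Mk (⟨d + 1, L, m, K, hd, hL⟩ : Params) j) t - rep (Mk (⟨d + 1, L, m, K, hd, hL⟩ : Params) j) t')) (fun a => latticeConst (d + 1) a) := torusDist_sumBound (Mk (⟨d + 1, L, m, K, hd, hL⟩ : Params) j)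
  -- (a) the ingredients at the common rate
  have b1 := l2blk_mono hρ (((((L : ℝ) ^ j) • (onE (LinearMap.funLeft ℝ ℝ (fun b : PBond (⟨d + 1, L, m, K, hd, hL⟩ : Params) 0 => (⟨b.src.shift lam, b.dir⟩ : PBond (⟨d + 1, L, m, K, hd, hL⟩ : Params) 0))) - LinearMap.id) : BondSpace (⟨d + 1, L, m, K, hd, hL⟩ : Params) →ₗ[ℝ] BondSpace (⟨d + 1, L, m, K, hd, hL⟩ : Params))) ∘ₗ ((((L : ℝ) ^ j) • (onE (LinearMap.funLeft ℝ ℝ (fun b : PBond (⟨d + 1, L, m, K, hd, hL⟩ : Params) 0 => (⟨b.src.shift mu, b.dir⟩ : PBond (⟨d + 1, L, m, K, hd, hL⟩ : Params) 0))) - LinearMap.id) : BondSpace (⟨d + 1, L, m, K, hd, hL⟩ : Params) →ₗ[ℝ] BondSpace (⟨d + 1, L, m, K, hd, hL⟩ : Params))) ∘ₗ (tsV1 hc Λ' w).K1) (fun b₀ : PBond (⟨d + 1, L, m, K, hd, hL⟩ : Params) 0 => iterBlockOf j b₀.src) (fun b₀ : PBond (⟨d + 1, L, m, K, hd, hL⟩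 : Params) 0 => iterBlockOf j b₀.src) hC₁ le_rfl (show δ₀ / 4 ≤ δ₁ by linarith) (hK1 m K j hc hj Λ' w hw lam mu)
  have b2 := l2blk_mono hρ (((((L : ℝ) ^ j) • (onE (LinearMap.funLeft ℝ ℝ (fun b : PBond (⟨d + 1, L, m, K, hd, hL⟩ : Params) 0 => (⟨b.src.shift lam, b.dir⟩ : PBond (⟨d + 1, L, m, K, hd, hL⟩ : Params) 0))) - LinearMap.id) : BondSpace (⟨d + 1, L, m, K, hd, hL⟩ : Params) →ₗ[ℝ] BondSpace (⟨d + 1, L, m, K, hd, hL⟩ : Params))) ∘ₗ ((((L : ℝ) ^ j) • (onE (LinearMap.funLeft ℝ ℝ (fun b : PBond (⟨d + 1, L, m, K, hd, hL⟩ : Params) 0 => (⟨b.src.shift mu, b.dir⟩ : PBond (⟨d + 1, L, m, K, hd, hL⟩ : Params) 0))) - LinearMap.id) : BondSpace (⟨d + 1, L, m, K, hd, hL⟩ : Params) →ₗ[ℝ] BondSpace (⟨d + 1, L, m, K, hd, hL⟩ : Params))) ∘ₗ LinearMap.adjoint (tsV1 hc Λ' w).K2) (fun b₀ : PBond (⟨d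 + 1, L, m, K, hd, hL⟩ : Params) 0 => iterBlockOf j b₀.src) (fun b₀ : PBond (⟨d + 1, L, m, K, hd, hL⟩ : Params) 0 => iterBlockOf j b₀.src) hC₂ le_rfl h02 (hK2a m K j hc hj Λ' w hw lam mu)
  have b3 := l2blk_mono hρ ((LinearMap.id - LinearMap.adjoint (tsV1 hc Λ' w).Qv ∘ₗ ((tsV1 hc Λ' w).Δj + (1 * ((L : ℝ) ^ j) ^ (d + 1)) • (LinearMap.id : UBond (⟨d + 1, L, m, K, hd, hL⟩ : Params) j →ₗ[ℝ] UBond (⟨d + 1, L, m, K, hd, hL⟩ : Params) j)) ∘ₗ (tsV1 hc Λ' w).Qv ∘ₗ (GE (Domains.whole (P := (⟨d + 1, L, m, K, hd, hL⟩ : Params)) j (Nat.le_of_succ_le hj)) hc (w := fun _ => 1 * ((L : ℝ) ^ j) ^ (d + 1)) (fun _ => hw')) + LinearMap.adjoint (tsV1 hc Λ' w).Qv ∘ₗ ((tsV1 hc Λ' w).Δj + (1 * ((L : ℝ) ^ j) ^ (d + 1)) • (LinearMap.id : UBond (⟨d + 1, L, m, K, hd, hL⟩ : Params) j →ₗ[ℝ]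 UBond (⟨d + 1, L, m, K, hd, hL⟩ : Params) j)) ∘ₗ (tsV1 hc Λ' w).Ct ∘ₗ LinearMap.adjoint (tsV1 hc Λ' w).Hj : BondSpace (⟨d + 1, L, m, K, hd, hL⟩ : Params) →ₗ[ℝ] BondSpace (⟨d + 1, L, m, K, hd, hL⟩ : Params))) (fun b₀ : PBond (⟨d + 1, L, m, K, hd, hL⟩ : Params) 0 => iterBlockOf j b₀.src) (fun b₀ : PBond (⟨d + 1, L, m, K, hd, hL⟩ : Params) 0 => iterBlockOf j b₀.src) hC₃ le_rfl h03 (hR0 m K j hc hj Λ' w hw0 hw1 hw')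
  have b4 := l2blk_mono hρ ((tsV1 hc Λ' w).Gt + (tsV1 hc Λ' w).Hj ∘ₗ (tsV1 hc Λ' w).Ct ∘ₗ LinearMap.adjoint (tsV1 hc Λ' w).Hj) (fun b₀ : PBond (⟨d + 1, L, m, K, hd, hL⟩ : Params) 0 => iterBlockOf j b₀.src) (fun b₀ : PBond (⟨d + 1, L, m, K, hd, hL⟩ : Params) 0 => iterBlockOf j b₀.src) hC₄ le_rfl h04 (hM m K j hc hj Λ' w hw0 hw1)
  have b5 := l2blk_mono hρ (tsV1 hc Λ' w).K2 (fun b₀ : PBond (⟨d + 1, L, m, K, hd, hL⟩ : Params) 0 => iterBlockOf j b₀.src) (fun b₀ : PBond (⟨d + 1, L, m, K, hd, hL⟩ : Params) 0 => iterBlockOf j b₀.src) hC₅ le_rfl h05 (hK2 m K j hc hj Λ' w hw)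
  have b6raw : ∀ (y₁ y₂ : Site (⟨d + 1, L, m, K, hd, hL⟩ : Params) j) (v' u' : BondSpace (⟨d + 1, L, m, K, hd, hL⟩ : Params)), (∀ b : PBond (⟨d + 1, L, m, K, hd, hL⟩ : Params) 0, iterBlockOf j b.src ≠ y₁ → v' b = 0) →
      (∀ b : PBond (⟨d + 1, L, m, K, hd, hL⟩ : Params) 0, iterBlockOf j b.src ≠ y₂ → u' b = 0) →
      |⟪v', (((((L : ℝ) ^ j) • (onE (LinearMap.funLeft ℝ ℝ (fun b : PBond (⟨d + 1, L, m, K, hd, hL⟩ : Params) 0 => (⟨b.src.shift lam, b.dir⟩ : PBond (⟨d + 1, L, m, K, hd, hL⟩ : Params) 0))) - LinearMap.id) : BondSpace (⟨d + 1, L, m, K, hd, hL⟩ : Params) →ₗ[ℝ] BondSpace (⟨d + 1, L, m, K, hd, hL⟩ : Params))) ∘ₗ ((((L : ℝ) ^ j) • (onE (LinearMap.funLeft ℝ ℝ (fun b : PBond (⟨d + 1, L, m, K, hd, hL⟩ : Params) 0 => (⟨b.src.shift mu, b.dir⟩ : PBond (⟨d + 1, L, m, K, hd, hL⟩ : Params)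 0))) - LinearMap.id) : BondSpace (⟨d + 1, L, m, K, hd, hL⟩ : Params) →ₗ[ℝ] BondSpace (⟨d + 1, L, m, K, hd, hL⟩ : Params))) ∘ₗ (GE (Domains.whole (P := (⟨d + 1, L, m, K, hd, hL⟩ : Params)) j (Nat.le_of_succ_le hj)) hc (w := fun _ => 1 * ((L : ℝ) ^ j) ^ (d + 1)) (fun _ => hw'))) u'⟫_ℝ| ≤ const114 (d + 1) 1 * Real.exp (-(delta114 (d + 1) 1 * torusSupNorm (Mk (⟨d + 1, L, m, K, hd, hL⟩ : Params) j) (rep (Mk (⟨d + 1, L, m, K, hd, hL⟩ : Params) j) y₁ - rep (Mk (⟨d + 1, L, m, K, hd, hL⟩ : Params) j) y₂))) * (‖v'‖ * ‖u'‖) :=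
    fun y₁ y₂ v' u' hv' hu' => l2blk_DDGE_scaling (Nat.le_of_succ_le hj) hc one_pos hw' lam mu y₁ y₂ v' u' hv' hu'
  have b6 := l2blk_mono hρ (((((L : ℝ) ^ j) • (onE (LinearMap.funLeft ℝ ℝ (fun b : PBond (⟨d + 1, L, m, K, hd, hL⟩ : Params) 0 => (⟨b.src.shift lam, b.dir⟩ : PBond (⟨d + 1, L, m, K, hd, hL⟩ : Params) 0))) - LinearMap.id) : BondSpace (⟨d + 1, L, m, K, hd, hL⟩ : Params) →ₗ[ℝ] BondSpace (⟨d + 1, L, m, K, hd, hL⟩ : Params))) ∘ₗ ((((L : ℝ) ^ j) • (onE (LinearMap.funLeft ℝ ℝ (fun b : PBond (⟨d + 1, L, m, K, hd, hL⟩ : Params) 0 => (⟨b.src.shift mu, b.dir⟩ : PBond (⟨d + 1, L, m, K, hd, hL⟩ : Params) 0))) - LinearMap.id) : BondSpace (⟨d + 1, L, m, K, hd, hL⟩ : Params) →ₗ[ℝ] BondSpace (⟨d + 1, L, m, K, hd, hL⟩ : Params))) ∘ₗ (GE (Domains.whole (P := (⟨d + 1, L, m, K, hd, hL⟩ : Params))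 j (Nat.le_of_succ_le hj)) hc (w := fun _ => 1 * ((L : ℝ) ^ j) ^ (d + 1)) (fun _ => hw'))) (fun b₀ : PBond (⟨d + 1, L, m, K, hd, hL⟩ : Params) 0 => iterBlockOf j b₀.src) (fun b₀ : PBond (⟨d + 1, L, m, K, hd, hL⟩ : Params) 0 => iterBlockOf j b₀.src) hC₆ le_rfl h06 b6raw
  have bid := l2blk_id hρ (fun b₀ : PBond (⟨d + 1, L, m, K, hd, hL⟩ : Params) 0 => iterBlockOf j b₀.src) δ₀
  -- (b) `I − K₂`, the two right factors, the two compositions, the sum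
  have bIK2 := l2blk_sub (ρ := (fun t t' : Site (⟨d + 1, L, m, K, hd, hL⟩ : Params) j => torusSupNorm (Mk (⟨d + 1, L, m, K, hd, hL⟩ : Params) j) (rep (Mk (⟨d + 1, L, m, K, hd, hL⟩ : Params) j) t - rep (Mk (⟨d + 1, L, m, K, hd, hL⟩ : Params) j) t'))) _ _ (fun b₀ : PBond (⟨d + 1, L, m, K, hd, hL⟩ : Params) 0 => iterBlockOf j b₀.src) (fun b₀ : PBond (⟨d + 1, L, m, K, hd, hL⟩ : Params) 0 => iterBlockOf j b₀.src) bid b5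
  have bSA := l2blk_comp hρ hK ((LinearMap.id - LinearMap.adjoint (tsV1 hc Λ' w).Qv ∘ₗ ((tsV1 hc Λ' w).Δj + (1 * ((L : ℝ) ^ j) ^ (d + 1)) • (LinearMap.id : UBond (⟨d + 1, L, m, K, hd, hL⟩ : Params) j →ₗ[ℝ] UBond (⟨d + 1, L, m, K, hd, hL⟩ : Params) j)) ∘ₗ (tsV1 hc Λ' w).Qv ∘ₗ (GE (Domains.whole (P := (⟨d + 1, L, m, K, hd, hL⟩ : Params)) j (Nat.le_of_succ_le hj)) hc (w := fun _ => 1 * ((L : ℝ) ^ j) ^ (d + 1)) (fun _ => hw')) + LinearMap.adjoint (tsV1 hc Λ' w).Qv ∘ₗ ((tsV1 hc Λ' w).Δj + (1 * ((L : ℝ) ^ j) ^ (d + 1)) • (LinearMap.id : UBond (⟨d + 1, L, m, K, hd, hL⟩ : Params) j →ₗ[ℝ] UBond (⟨d + 1, L, m, K, hd, hL⟩ : Params) j)) ∘ₗ (tsV1 hc Λ' w).Ct ∘ₗ LinearMap.adjoint (tsV1 hc Λ' w).Hj : BondSpace (⟨d + 1, L, m, K, hd, hL⟩ : Params) →ₗ[ℝ]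 BondSpace (⟨d + 1, L, m, K, hd, hL⟩ : Params))) (LinearMap.id - (tsV1 hc Λ' w).K2) (fun b₀ : PBond (⟨d + 1, L, m, K, hd, hL⟩ : Params) 0 => iterBlockOf j b₀.src) (fun b₀ : PBond (⟨d + 1, L, m, K, hd, hL⟩ : Params) 0 => iterBlockOf j b₀.src) (fun b₀ : PBond (⟨d + 1, L, m, K, hd, hL⟩ : Params) 0 => iterBlockOf j b₀.src) (Cf := C₃) (Cg := 1 + C₅) (a := δ₀) (b := δ₀) (δ' := δ₀ / 2) hC₃ (by positivity)
    (show (0 : ℝ) ≤ δ₀ / 2 by positivity) (show δ₀ / 2 ≤ δ₀ by linarith) (show δ₀ / 2 < δ₀ by linarith) b3 bIK2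
  have bSB := l2blk_comp hρ hK ((tsV1 hc Λ' w).Gt + (tsV1 hc Λ' w).Hj ∘ₗ (tsV1 hc Λ' w).Ct ∘ₗ LinearMap.adjoint (tsV1 hc Λ' w).Hj) (LinearMap.id - (tsV1 hc Λ' w).K2) (fun b₀ : PBond (⟨d + 1, L, m, K, hd, hL⟩ : Params) 0 => iterBlockOf j b₀.src) (fun b₀ : PBond (⟨d + 1, L, m, K, hd, hL⟩ : Params) 0 => iterBlockOf j b₀.src) (fun b₀ : PBond (⟨d + 1, L, m, K, hd, hL⟩ : Params) 0 => iterBlockOf j b₀.src) (Cf := C₄) (Cg := 1 + C₅) (a := δ₀) (b := δ₀) (δ' := δ₀ / 2) hC₄ (by positivity)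
    (show (0 : ℝ) ≤ δ₀ / 2 by positivity) (show δ₀ / 2 ≤ δ₀ by linarith) (show δ₀ / 2 < δ₀ by linarith) b4 bIK2
  have bA := l2blk_comp hρ hK (((((L : ℝ) ^ j) • (onE (LinearMap.funLeft ℝ ℝ (fun b : PBond (⟨d + 1, L, m, K, hd, hL⟩ : Params) 0 => (⟨b.src.shift lam, b.dir⟩ : PBond (⟨d + 1, L, m, K, hd, hL⟩ : Params) 0))) - LinearMap.id) : BondSpace (⟨d + 1, L, m, K, hd, hL⟩ : Params) →ₗ[ℝ] BondSpace (⟨d + 1, L, m, K, hd, hL⟩ : Params))) ∘ₗ ((((L : ℝ) ^ j) • (onE (LinearMap.funLeft ℝ ℝ (fun b : PBond (⟨d + 1, L, m, K, hd, hL⟩ : Params) 0 => (⟨b.src.shift mu, b.dir⟩ : PBond (⟨d + 1, L, m, K, hd, hL⟩ : Params) 0))) - LinearMap.id) : BondSpace (⟨d + 1, L, m, K, hd, hL⟩ : Params) →ₗ[ℝ] BondSpace (⟨d + 1, L, m, K, hd, hL⟩ : Params))) ∘ₗ (GE (Domains.whole (P := (⟨d + 1, L, m, K, hd, hL⟩ :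 Params)) j (Nat.le_of_succ_le hj)) hc (w := fun _ => 1 * ((L : ℝ) ^ j) ^ (d + 1)) (fun _ => hw'))) (((LinearMap.id - LinearMap.adjoint (tsV1 hc Λ' w).Qv ∘ₗ ((tsV1 hc Λ' w).Δj + (1 * ((L : ℝ) ^ j) ^ (d + 1)) • (LinearMap.id : UBond (⟨d + 1, L, m, K, hd, hL⟩ : Params) j →ₗ[ℝ] UBond (⟨d + 1, L, m, K, hd, hL⟩ : Params) j)) ∘ₗ (tsV1 hc Λ' w).Qv ∘ₗ (GE (Domains.whole (P := (⟨d + 1, L, m, K, hd, hL⟩ : Params)) j (Nat.le_of_succ_le hj)) hc (w := fun _ => 1 * ((L : ℝ) ^ j) ^ (d + 1)) (fun _ => hw')) + LinearMap.adjoint (tsV1 hc Λ' w).Qv ∘ₗ ((tsV1 hc Λ' w).Δj + (1 * ((L : ℝ) ^ j) ^ (d + 1)) • (LinearMap.id : UBond (⟨d + 1, L, m, K, hd, hL⟩ : Params) j →ₗ[ℝ] UBond (⟨d + 1, L, m, K, hd, hL⟩ : Params) j)) ∘ₗ (tsV1 hc Λ' w).Ct ∘ₗ LinearMap.adjoint (tsV1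 hc Λ' w).Hj : BondSpace (⟨d + 1, L, m, K, hd, hL⟩ : Params) →ₗ[ℝ] BondSpace (⟨d + 1, L, m, K, hd, hL⟩ : Params))) ∘ₗ (LinearMap.id - (tsV1 hc Λ' w).K2)) (fun b₀ : PBond (⟨d + 1, L, m, K, hd, hL⟩ : Params) 0 => iterBlockOf j b₀.src) (fun b₀ : PBond (⟨d + 1, L, m, K, hd, hL⟩ : Params) 0 => iterBlockOf j b₀.src) (fun b₀ : PBond (⟨d + 1, L, m, K, hd, hL⟩ : Params) 0 => iterBlockOf j b₀.src) (Cf := const114 (d + 1) 1) (Cg := C₃ * (1 + C₅) * Ka)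
    (a := δ₀) (b := δ₀ / 2) (δ' := δ₀ / 4) hC₆ (by positivity)
    (show (0 : ℝ) ≤ δ₀ / 4 by positivity) (show δ₀ / 4 ≤ δ₀ / 2 by linarith) (show δ₀ / 4 < δ₀ by linarith) b6 bSA
  have bB := l2blk_comp hρ hK (((((L : ℝ) ^ j) • (onE (LinearMap.funLeft ℝ ℝ (fun b : PBond (⟨d + 1, L, m, K, hd, hL⟩ : Params) 0 => (⟨b.src.shift lam, b.dir⟩ : PBond (⟨d + 1, L, m, K, hd, hL⟩ : Params) 0))) - LinearMap.id) : BondSpace (⟨d + 1, L, m, K, hd, hL⟩ : Params) →ₗ[ℝ] BondSpace (⟨d + 1, L, m, K, hd, hL⟩ : Params))) ∘ₗ ((((L : ℝ) ^ j) • (onE (LinearMap.funLeft ℝ ℝ (fun b : PBond (⟨d + 1, L, m, K, hd, hL⟩ : Params) 0 => (⟨b.src.shift mu, b.dir⟩ : PBond (⟨d + 1, L, m, K, hd, hL⟩ : Params) 0))) - LinearMap.id) : BondSpace (⟨d + 1, L, m, K, hd, hL⟩ : Params) →ₗ[ℝ] BondSpace (⟨d + 1, L, m, K, hd, hL⟩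 : Params))) ∘ₗ LinearMap.adjoint (tsV1 hc Λ' w).K2) (((tsV1 hc Λ' w).Gt + (tsV1 hc Λ' w).Hj ∘ₗ (tsV1 hc Λ' w).Ct ∘ₗ LinearMap.adjoint (tsV1 hc Λ' w).Hj) ∘ₗ (LinearMap.id - (tsV1 hc Λ' w).K2)) (fun b₀ : PBond (⟨d + 1, L, m, K, hd, hL⟩ : Params) 0 => iterBlockOf j b₀.src) (fun b₀ : PBond (⟨d + 1, L, m, K, hd, hL⟩ : Params) 0 => iterBlockOf j b₀.src) (fun b₀ : PBond (⟨d + 1, L, m, K, hd, hL⟩ : Params) 0 => iterBlockOf j b₀.src) (Cf := C₂) (Cg := C₄ * (1 + C₅) * Ka)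
    (a := δ₀) (b := δ₀ / 2) (δ' := δ₀ / 4) hC₂ (by positivity)
    (show (0 : ℝ) ≤ δ₀ / 4 by positivity) (show δ₀ / 4 ≤ δ₀ / 2 by linarith) (show δ₀ / 4 < δ₀ by linarith) b2 bSB
  have bsum := l2blk_add (ρ := (fun t t' : Site (⟨d + 1, L, m, K, hd, hL⟩ : Params) j => torusSupNorm (Mk (⟨d + 1, L, m, K, hd, hL⟩ : Params) j) (rep (Mk (⟨d + 1, L, m, K, hd, hL⟩ : Params) j) t - rep (Mk (⟨d + 1, L, m, K, hd, hL⟩ : Params) j) t'))) _ _ (fun b₀ : PBond (⟨d + 1, L, m, K, hd, hL⟩ : Params) 0 => iterBlockOf j b₀.src) (fun b₀ : PBond (⟨d + 1, L, m, K, hd, hL⟩ : Params) 0 => iterBlockOf j b₀.src) b1 bA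
  have btot := l2blk_sub (ρ := (fun t t' : Site (⟨d + 1, L, m, K, hd, hL⟩ : Params) j => torusSupNorm (Mk (⟨d + 1, L, m, K, hd, hL⟩ : Params) j) (rep (Mk (⟨d + 1, L, m, K, hd, hL⟩ : Params) j) t - rep (Mk (⟨d + 1, L, m, K, hd, hL⟩ : Params) j) t'))) _ _ (fun b₀ : PBond (⟨d + 1, L, m, K, hd, hL⟩ : Params) 0 => iterBlockOf j b₀.src) (fun b₀ : PBond (⟨d + 1, L, m, K, hd, hL⟩ : Params) 0 => iterBlockOf j b₀.src) bsum bB y y' v u hv hu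
  rw [DDG_eq hc hj Λ' hw hw' lam mu]
  refine btot.trans (le_of_eq ?_)
  rw [hC, hKa, hKb]

/-! ## §3  The printed shapes: the members `‖ζ∇∇GJ‖` and `‖ζG∇*∇*J‖` of (1.114) for the two-scale `G` -/

open Classical in
/-- **PROPOSITION 2.5, THE MEMBER `‖ζ∇_λ∇_μGJ‖` OF (1.114) IN THE PRINTED SHAPE** for the genuine two-scale `G` of (2.90), `Λ′` arbitrary (at
`c = L^j`, weights `a₀n^{d+1} ≤ w ≤ a₁n^{d+1}`): there are `δ₂ > 0`, `C ≥ 0` depending on `d, L, a₀, a₁` only such that for every volume,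
`j + 1 ≤ m + K`, `Λ′`, weights in the window, directions `λ, μ`, every radius `r ≥ 0`, every fine bond field `J` supported on the fine bonds over the
unit sites within `r` of `y′`, every cut-off `ζ` on the fine sites supported over the unit sites within `r` of `y` with `|ζ| ≤ Z`:
`Σ_{b₀}(ζ(b₀₋)·(∇_λ∇_μGJ)(b₀))² ≤ (C·e^{(1+2δ₂)r}·e^{−δ₂|y − y′|_T}·Z)²·‖J‖²`, i.e. `‖ζ∇_λ∇_μGJ‖ ≤ C e^{(1+2δ₂)r}e^{−δ₂|y−y′|}|ζ|‖J‖` (`r = 1`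
contains [4]'s cubes `Δ̃`). [cite: Balaban1984PropagatorsII, Prop. 2.5 p.246; Balaban1984PropagatorsI, Prop. 1.2 (1.114) p.36] -/
theorem prop25_ineq114_gradgrad (d L : ℕ) (hd : 1 ≤ d + 1) (hL : Odd L ∧ 1 < L) {a₀ a₁ : ℝ} (ha₀ : 0 < a₀) (ha₁ : a₀ ≤ a₁) :
    ∃ δ : ℝ, 0 < δ ∧ ∃ C : ℝ, 0 ≤ C ∧ ∀ (m K : ℕ) (j : ℕ) (hc : ((L : ℝ) ^ j) ≠ 0)
      (_hj : j + 1 ≤ (⟨d + 1, L, m, K, hd, hL⟩ : Params).m + (⟨d + 1, L, m, K, hd, hL⟩ : Params).K)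
      (Λ' : Finset (Site (⟨d + 1, L, m, K, hd, hL⟩ : Params) (j + 1))) (w : CIdx j Λ' → ℝ)
      (_hw0 : ∀ i, a₀ * ((L : ℝ) ^ j) ^ (d + 1) ≤ w i) (_hw1 : ∀ i, w i ≤ a₁ * ((L : ℝ) ^ j) ^ (d + 1)) (lam mu : Fin (d + 1))
      (r : ℝ) (_hr : 0 ≤ r) (J : BondSpace (⟨d + 1, L, m, K, hd, hL⟩ : Params)) (ζ : Site (⟨d + 1, L, m, K, hd, hL⟩ : Params) 0 → ℝ) (Z : ℝ) (_hZ : 0 ≤ Z) (y y' : Site (⟨d + 1, L, m, K, hd, hL⟩ : Params) j)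
      (_hsuppJ : ∀ b : PBond (⟨d + 1, L, m, K, hd, hL⟩ : Params) 0, J b ≠ 0 → torusSupNorm (Mk (⟨d + 1, L, m, K, hd, hL⟩ : Params) j) (rep (Mk (⟨d + 1, L, m, K, hd, hL⟩ : Params) j) (iterBlockOf j b.src) - rep (Mk (⟨d + 1, L, m, K, hd, hL⟩ : Params) j) y') ≤ r)
      (_hsuppζ : ∀ x : Site (⟨d + 1, L, m, K, hd, hL⟩ : Params) 0, ζ x ≠ 0 → torusSupNorm (Mk (⟨d + 1, L, m, K, hd, hL⟩ : Params) j) (rep (Mk (⟨d + 1, L, m, K, hd, hL⟩ : Params) j) (iterBlockOf j x) - rep (Mk (⟨d + 1, L, m, K, hd, hL⟩ : Params) j) y) ≤ r)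
      (_hζ : ∀ x : Site (⟨d + 1, L, m, K, hd, hL⟩ : Params) 0, |ζ x| ≤ Z),
      ∑ b₀ : PBond (⟨d + 1, L, m, K, hd, hL⟩ : Params) 0, (ζ b₀.src * (((((L : ℝ) ^ j) • (onE (LinearMap.funLeft ℝ ℝ (fun b : PBond (⟨d + 1, L, m, K, hd, hL⟩ : Params) 0 => (⟨b.src.shift lam, b.dir⟩ : PBond (⟨d + 1, L, m, K, hd, hL⟩ : Params) 0))) - LinearMap.id) : BondSpace (⟨d + 1, L, m, K, hd, hL⟩ : Params) →ₗ[ℝ] BondSpace (⟨d + 1, L, m, K, hd, hL⟩ : Params))) (((((L : ℝ) ^ j) • (onE (LinearMap.funLeft ℝ ℝ (fun b : PBond (⟨d + 1, L, m, K, hd, hL⟩ : Params) 0 => (⟨b.src.shift mu, b.dir⟩ : PBond (⟨d + 1, L, m, K, hd, hL⟩ : Params) 0))) - LinearMap.id) : BondSpace (⟨d + 1, L, m, K, hd, hL⟩ : Params) →ₗ[ℝ] BondSpace (⟨d + 1, L, m, K, hd, hL⟩ : Params))) ((tsV1 hc Λ' w).G J))) b₀) ^ 2 ≤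
        (C * Real.exp ((1 + 2 * δ) * r) * Real.exp (-(δ * torusSupNorm (Mk (⟨d + 1, L, m, K, hd, hL⟩ : Params) j) (rep (Mk (⟨d + 1, L, m, K, hd, hL⟩ : Params) j) y - rep (Mk (⟨d + 1, L, m, K, hd, hL⟩ : Params) j) y'))) * Z) ^ 2 * ‖J‖ ^ 2 := by
  obtain ⟨δ, hδ, C, hC, h⟩ := l2blk_DDG_scaling d L hd hL ha₀ ha₁
  refine ⟨δ, hδ, C * latticeConst (d + 1) 1, mul_nonneg hC (latticeConst_nonneg _ zero_le_one), ?_⟩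
  intro m K j hc hj Λ' w hw0 hw1 lam mu r hr J ζ Z hZ y y' hsuppJ hsuppζ hζ
  have hρ : IsPseudoDist (fun t t' : Site (⟨d + 1, L, m, K, hd, hL⟩ : Params) j => torusSupNorm (Mk (⟨d + 1, L, m, K, hd, hL⟩ : Params) j) (rep (Mk (⟨d + 1, L, m, K, hd, hL⟩ : Params) j) t - rep (Mk (⟨d + 1, L, m, K, hd, hL⟩ : Params) j) t')) := torusDist_isPseudoDist (Mk (⟨d + 1, L, m, K, hd, hL⟩ : Params) j)
  have hK : SumBound (fun t t' : Site (⟨d + 1, L, m, K, hd, hL⟩ : Params) j => torusSupNorm (Mk (⟨d + 1, L, m, K, hd, hL⟩ : Params) j) (rep (Mk (⟨d + 1, L, m, K, hd, hL⟩ : Params) j) t - rep (Mk (⟨d + 1, L, m, K, hd, hL⟩ : Params) j) t')) (fun a => latticeConst (d + 1) a) := torusDist_sumBound (Mk (⟨d + 1, L, m, K, hd, hL⟩ : Params) j)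
  have h' := normSq_cut_apply_le_of_l2blk hρ hK (((((L : ℝ) ^ j) • (onE (LinearMap.funLeft ℝ ℝ (fun b : PBond (⟨d + 1, L, m, K, hd, hL⟩ : Params) 0 => (⟨b.src.shift lam, b.dir⟩ : PBond (⟨d + 1, L, m, K, hd, hL⟩ : Params) 0))) - LinearMap.id) : BondSpace (⟨d + 1, L, m, K, hd, hL⟩ : Params) →ₗ[ℝ] BondSpace (⟨d + 1, L, m, K, hd, hL⟩ : Params))) ∘ₗ ((((L : ℝ) ^ j) • (onE (LinearMap.funLeft ℝ ℝ (fun b : PBond (⟨d + 1, L, m, K, hd, hL⟩ : Params) 0 => (⟨b.src.shift mu, b.dir⟩ : PBond (⟨d + 1, L, m, K, hd, hL⟩ : Params) 0))) - LinearMap.id) : BondSpace (⟨d + 1, L, m, K, hd, hL⟩ : Params) →ₗ[ℝ] BondSpace (⟨d + 1, L, m, K, hd, hL⟩ : Params))) ∘ₗ (tsV1 hc Λ' w).G) (fun b₀ : PBond (⟨d + 1, L, m, K, hd, hL⟩ : Params) 0 => iterBlockOf j b₀.src) (fun b₀ : PBond (⟨d + 1, L, m, K, hd, hL⟩ : Params)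 0 => iterBlockOf j b₀.src) hC hδ.le hZ (h m K j hc hj Λ' w hw0 hw1 lam mu) J
    (fun b₀ : PBond (⟨d + 1, L, m, K, hd, hL⟩ : Params) 0 => ζ b₀.src) y y' hsuppJ (fun b₀ hb => hsuppζ b₀.src hb) (fun b₀ => hζ b₀.src)
  refine h'.trans (le_of_eq ?_)
  ring

open Classical in
/-- **PROPOSITION 2.5, THE MEMBER `‖ζG∇_μ*∇_λ*J‖` OF (1.114) IN THE PRINTED SHAPE** for the genuine two-scale `G` (by adjunction from
`l2blk_DDG_scaling`: `G* = G`, `(∇_λ∇_μG)* = G∇_μ*∇_λ*`; file 23's `l2blk_adjoint`), same quantifiers as `prop25_ineq114_gradgrad`: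
`Σ_{b₀}(ζ(b₀₋)·(G∇_μ*∇_λ*J)(b₀))² ≤ (C·e^{(1+2δ₂)r}·e^{−δ₂|y − y′|_T}·Z)²·‖J‖²`. [cite: Balaban1984PropagatorsII, Prop. 2.5 p.246; Balaban1984PropagatorsI, Prop. 1.2 (1.114) p.36] -/
theorem prop25_ineq114_GDadjDadj (d L : ℕ) (hd : 1 ≤ d + 1) (hL : Odd L ∧ 1 < L) {a₀ a₁ : ℝ} (ha₀ : 0 < a₀) (ha₁ : a₀ ≤ a₁) :
    ∃ δ : ℝ, 0 < δ ∧ ∃ C : ℝ, 0 ≤ C ∧ ∀ (m K : ℕ) (j : ℕ) (hc : ((L : ℝ) ^ j) ≠ 0)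
      (_hj : j + 1 ≤ (⟨d + 1, L, m, K, hd, hL⟩ : Params).m + (⟨d + 1, L, m, K, hd, hL⟩ : Params).K)
      (Λ' : Finset (Site (⟨d + 1, L, m, K, hd, hL⟩ : Params) (j + 1))) (w : CIdx j Λ' → ℝ)
      (_hw0 : ∀ i, a₀ * ((L : ℝ) ^ j) ^ (d + 1) ≤ w i) (_hw1 : ∀ i, w i ≤ a₁ * ((L : ℝ) ^ j) ^ (d + 1)) (lam mu : Fin (d + 1))
      (r : ℝ) (_hr : 0 ≤ r) (J : BondSpace (⟨d + 1, L, m, K, hd, hL⟩ : Params)) (ζ : Site (⟨d + 1, L, m, K, hd, hL⟩ : Params) 0 → ℝ) (Z : ℝ) (_hZ : 0 ≤ Z) (y y' : Site (⟨d + 1, L, m, K, hd, hL⟩ : Params) j)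
      (_hsuppJ : ∀ b : PBond (⟨d + 1, L, m, K, hd, hL⟩ : Params) 0, J b ≠ 0 → torusSupNorm (Mk (⟨d + 1, L, m, K, hd, hL⟩ : Params) j) (rep (Mk (⟨d + 1, L, m, K, hd, hL⟩ : Params) j) (iterBlockOf j b.src) - rep (Mk (⟨d + 1, L, m, K, hd, hL⟩ : Params) j) y') ≤ r)
      (_hsuppζ : ∀ x : Site (⟨d + 1, L, m, K, hd, hL⟩ : Params) 0, ζ x ≠ 0 → torusSupNorm (Mk (⟨d + 1, L, m, K, hd, hL⟩ : Params) j) (rep (Mk (⟨d + 1, L, m, K, hd, hL⟩ : Params) j) (iterBlockOf j x) - rep (Mk (⟨d + 1, L, m, K, hd, hL⟩ : Params) j) y) ≤ r)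
      (_hζ : ∀ x : Site (⟨d + 1, L, m, K, hd, hL⟩ : Params) 0, |ζ x| ≤ Z),
      ∑ b₀ : PBond (⟨d + 1, L, m, K, hd, hL⟩ : Params) 0, (ζ b₀.src * ((tsV1 hc Λ' w).G (((((L : ℝ) ^ j) • (onE (LinearMap.funLeft ℝ ℝ (fun b : PBond (⟨d + 1, L, m, K, hd, hL⟩ : Params) 0 => (⟨b.src.unshift mu, b.dir⟩ : PBond (⟨d + 1, L, m, K, hd, hL⟩ : Params) 0))) - LinearMap.id) : BondSpace (⟨d + 1, L, m, K, hd, hL⟩ : Params) →ₗ[ℝ] BondSpace (⟨d + 1, L, m, K, hd, hL⟩ : Params))) (((((L : ℝ) ^ j) • (onE (LinearMap.funLeft ℝ ℝ (fun b : PBond (⟨d + 1, L, m, K, hd, hL⟩ : Params) 0 => (⟨b.src.unshift lam, b.dir⟩ : PBond (⟨d + 1, L, m, K, hd, hL⟩ : Params) 0))) - LinearMap.id) : BondSpace (⟨d + 1, L, m, K, hd, hL⟩ : Params) →ₗ[ℝ] BondSpace (⟨d + 1, L, m, K, hd, hL⟩ : Params))) J))) b₀) ^ 2 ≤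
        (C * Real.exp ((1 + 2 * δ) * r) * Real.exp (-(δ * torusSupNorm (Mk (⟨d + 1, L, m, K, hd, hL⟩ : Params) j) (rep (Mk (⟨d + 1, L, m, K, hd, hL⟩ : Params) j) y - rep (Mk (⟨d + 1, L, m, K, hd, hL⟩ : Params) j) y'))) * Z) ^ 2 * ‖J‖ ^ 2 := by
  obtain ⟨δ, hδ, C, hC, h⟩ := l2blk_DDG_scaling d L hd hL ha₀ ha₁
  refine ⟨δ, hδ, C * latticeConst (d + 1) 1, mul_nonneg hC (latticeConst_nonneg _ zero_le_one), ?_⟩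
  intro m K j hc hj Λ' w hw0 hw1 lam mu r hr J ζ Z hZ y y' hsuppJ hsuppζ hζ
  have hL0 : 0 < L := by have := hL.2; omega
  have hLp : (0 : ℝ) < L := by exact_mod_cast hL0
  have hw : ∀ i, 0 < w i := fun i => lt_of_lt_of_le (by positivity) (hw0 i)
  have hρ : IsPseudoDist (fun t t' : Site (⟨d + 1, L, m, K, hd, hL⟩ : Params) j => torusSupNorm (Mk (⟨d + 1, L, m, K, hd, hL⟩ : Params) j) (rep (Mk (⟨d + 1, L, m, K, hd, hL⟩ : Params) j) t - rep (Mk (⟨d + 1, L, m, K, hd, hL⟩ : Params) j) t')) := torusDist_isPseudoDist (Mk (⟨d + 1, L, m, K, hd, hL⟩ : Params) j)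
  have hK : SumBound (fun t t' : Site (⟨d + 1, L, m, K, hd, hL⟩ : Params) j => torusSupNorm (Mk (⟨d + 1, L, m, K, hd, hL⟩ : Params) j) (rep (Mk (⟨d + 1, L, m, K, hd, hL⟩ : Params) j) t - rep (Mk (⟨d + 1, L, m, K, hd, hL⟩ : Params) j) t')) (fun a => latticeConst (d + 1) a) := torusDist_sumBound (Mk (⟨d + 1, L, m, K, hd, hL⟩ : Params) j)
  have hadj := l2blk_adjoint hρ (((((L : ℝ) ^ j) • (onE (LinearMap.funLeft ℝ ℝ (fun b : PBond (⟨d + 1, L, m, K, hd, hL⟩ : Params) 0 => (⟨b.src.shift lam, b.dir⟩ : PBond (⟨d + 1, L, m, K, hd, hL⟩ : Params) 0))) - LinearMap.id) : BondSpace (⟨d + 1, L, m, K, hd, hL⟩ : Params) →ₗ[ℝ] BondSpace (⟨d + 1, L, m, K, hd, hL⟩ : Params))) ∘ₗ ((((L : ℝ) ^ j) • (onE (LinearMap.funLeft ℝ ℝ (fun b : PBond (⟨d + 1, L, m, K, hd, hL⟩ : Params) 0 => (⟨b.src.shift mu, b.dir⟩ : PBond (⟨d + 1, L, m, K, hd,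 hL⟩ : Params) 0))) - LinearMap.id) : BondSpace (⟨d + 1, L, m, K, hd, hL⟩ : Params) →ₗ[ℝ] BondSpace (⟨d + 1, L, m, K, hd, hL⟩ : Params))) ∘ₗ (tsV1 hc Λ' w).G) (fun b₀ : PBond (⟨d + 1, L, m, K, hd, hL⟩ : Params) 0 => iterBlockOf j b₀.src) (fun b₀ : PBond (⟨d + 1, L, m, K, hd, hL⟩ : Params) 0 => iterBlockOf j b₀.src) (h m K j hc hj Λ' w hw0 hw1 lam mu)
  rw [adjoint_DDG_eq hc hj Λ' hw lam mu] at hadj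
  have h' := normSq_cut_apply_le_of_l2blk hρ hK ((tsV1 hc Λ' w).G ∘ₗ ((((L : ℝ) ^ j) • (onE (LinearMap.funLeft ℝ ℝ (fun b : PBond (⟨d + 1, L, m, K, hd, hL⟩ : Params) 0 => (⟨b.src.unshift mu, b.dir⟩ : PBond (⟨d + 1, L, m, K, hd, hL⟩ : Params) 0))) - LinearMap.id) : BondSpace (⟨d + 1, L, m, K, hd, hL⟩ : Params) →ₗ[ℝ] BondSpace (⟨d + 1, L, m, K, hd, hL⟩ : Params))) ∘ₗ ((((L : ℝ) ^ j) • (onE (LinearMap.funLeft ℝ ℝ (fun b : PBond (⟨d + 1, L, m, K, hd, hL⟩ : Params) 0 => (⟨b.src.unshift lam, b.dir⟩ : PBond (⟨d + 1, L, m, K, hd, hL⟩ : Params) 0))) - LinearMap.id) : BondSpace (⟨d + 1, L, m, K, hd, hL⟩ : Params) →ₗ[ℝ] BondSpace (⟨d + 1, L, m, K, hd, hL⟩ : Params)))) (fun b₀ : PBond (⟨d + 1, L, m, K, hd, hL⟩ : Params) 0 => iterBlockOf j b₀.src) (fun b₀ : PBond (⟨d + 1, L, m, K, hd, hL⟩ :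 Params) 0 => iterBlockOf j b₀.src) hC hδ.le hZ hadj J
    (fun b₀ : PBond (⟨d + 1, L, m, K, hd, hL⟩ : Params) 0 => ζ b₀.src) y y' hsuppJ (fun b₀ hb => hsuppζ b₀.src hb) (fun b₀ => hζ b₀.src)
  refine h'.trans (le_of_eq ?_)
  ring

end Literature.MathematicalPhysics.QuantumFieldTheory.Balaban1983to89.B6Prop25Grad2DecayTwoScaleV1

end
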